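import Literature.MathematicalPhysics.QuantumFieldTheory.Balaban1983to89.B15Prop1GradientFromNearValueAtCoPRecord

/-!
# `Balaban1983to89.B15Prop1AtZSequenceRecord` — [Balaban1989LargeFieldI] (1.74) p. 192, Prop. 1 p. 194 / [Balaban1988Convergent] (2.12)–(2.13)
# pp. 256–257 / [Balaban1985Variational] (2), (5), (6) p. 278: ★★★ PROPOSITION 1 [IV] AT PRINT'S OWN (1.74) OBJECT — the (2.12) solution map whose
# regularity class AND determining set both come from the maximal sequence `{Ω_n(Z)}` of the large-field region `Z` — and the per-instance-background
# editions of the record endpoints it rests on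

Honest framing: statement-level skeleton of published theorems with citation tags; proofs where landed; nothing here is a claim about
the Yang–Mills mass gap.

Cell pub-ymgap, HUMAN RULING D-0062 (Track A full width), seat `pub-ymgap-dag-n12-c` (R134 acceleration seat (a), strategy s1 of DAG node N12 = [B15];
generation g10).  LOCATED-CLASS (this seat's self-audit of the lineage's record twins, cell bus 2026-08-27):

* PRINT.  [IV] p. 192 (1.74): *«U_{k,Z} = U_{k,Z}(V_k) = U(𝔹_k(Z), M˙(Q_k^{s*}V_k))»*.  [III] p. 256 (2.12): *«U → A^η(U) on U : U regular and M_𝐁(U) = V …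
  For precise definitions and the theory of this variational problem see [15]»*; pp. 256–257 (2.13): *«We denote this determining set by 𝐁_j(Ω), and the
  corresponding minimal configurations by U(𝐁_j(Ω),·) = U_{j,Ω}(·)»*.  [15] p. 278: the class (2) *«|U(∂p) − 1| < ε₀L^{−2j} for p ∈ Ω_j, j = 0, 1, …, k»*
  (with its co-divergence member), the action (5) *«A(U) = Σ_{p⊂Ω₀} η^{d−4}[1 − Re tr U(∂p)]»* and the space (6) all belong to THE SAME sequence `{Ω_j}`
  whose determining set `𝔅_k` carries the constraints (3).  So `U_{k,Z}` minimises over the class of `Z`'s OWN maximal sequence `{Ω_n(Z)}_{n=0}^{k}`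
  (`Ω₀(Z) = Z`), the sequence r11 typed as `B14.Eq213DetSet.maxDomT M₁ Z` (`Bj M₁ Z k = genSet (maxDomT M₁ Z) k` by `rfl`, `maxDomT_zero`).
* TREE.  NODE 00's typed reading agrees: `Node00.regMSCoPOfRecordAt ν K k Ω₀ Ω` is [15] (2) for the sequence `topSeq Ω₀ Ω`, and the named facts
  `Node00.VariationalThm1RegSep{Top7M,CoP7M}` take the class and the pairing `genSet s.Ω k` from ONE sequence `s`.  The lineage's record-13-`CoP`
  twins (`B15Prop1IntrinsicAtCoPRecord` p529759, `B15Prop1GradientFromValueAtCoPRecord` p534598, `B15Prop1GradientFromNearValueAtCoPRecord` §1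
  p540333) instead instantiate `bg := Node00.bgMSCoPOfRecord F 2 ν Kt kr Ω_run` — the class of the RUN's sequence — while the pairing is `Z`'s
  `Bj ν.M₁ Z k`: a (2.12) problem print never poses.  They remain sound theorems; for consumption they are SUPERSEDED by §2 below.
* REPAIR (this file).  The generic endpoints of the chain (`…_ofRecord`, p527900; `…_ofRecord_ofNearValue`, p538229 §3; any gauge-invariant class)
  already cover the printed object, but only with ONE background for the whole instance family; the printed object needs the background to vary
  with the instance (`Z`, `k`).  §1 states both record endpoints with a PER-INSTANCE background `Node00.bgOfRecord (av i) (reg i)` and cube letter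
  `M₁ i` (same proofs: `B15Prop1IntrinsicOfFun.…_ofFun_intrinsic_analytic` + `B15Eq177ValueInvariance.fun177std_bgOfRecord_gaugeAct` (+
  `hJ_of_nearValue` + `fun177std_dichotomy`)); §2 instantiates them AT PRINT'S (1.74) OBJECT: per instance
  `Node00.bgMSCoPOfRecord F 2 ν Kt (k i) (maxDomT ν.M₁ (Z i))` — NODE 00's v1.5 background constructor of record (def-R FILE 22′) applied to `Z`'s
  maximal sequence (support of record `hull(Ω₁(Z))`, [III] p. 255) — and §3 the twin with print's full top domain `Ω₀ = Z` as support,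
  `Node00.bgMSCoPOfRecordAt F 2 ν Kt (k i) (Z i) (maxDomT ν.M₁ (Z i))`; the class invariance DISCHARGED by
  `B15Eq177ValueInvarianceCoDiv.gaugeAct_mem_regMSCoPOfRecord[At]` (g6, PROVED).  The two differ only by the scale-`0` class clause on the pinned
  collar `Z ∖ hull(Ω₁(Z))` (a feasibility condition on the datum).

LOCATED-GENFORM (recorded, not typed here).  At this background the near-value letter (Vn) of §2 — print's (8) *«|∂U_{k,Z} − 1| < O(1)B₃M²εη²»*
([IV] p. 193 ll. 17–20) summed over the plaquettes meeting `Ω₁(Z)` (`B15Prop1GradientFromNearValueAtCoPRecord.nearValue_le_of_plaqSmallOn`) — is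
[15] Thm 1 (7)⇒(8) FOR THE ADMISSIBLE SEQUENCE `maxDomT ν.M₁ Z` (unions of `LʲM₁`-cubes), i.e. the GENERAL FORM of `Node00.VariationalThm1RegSepCoP7M`
(its own «TODO(general form)»): the tree's facts are indexed by `s : Node00.SeqOfRecord F ν M g K k` (unions of `LʲMR_j`-cubes) and do not instantiate
at `Z`'s sequence.  That general-sequence [15]-leaf is a NODE 00 edition; (J1)∕(L2) are NODE 00's as before.

TYPING (instance hygiene, as p529759∕p540333).  This module imports the NODE 00 `CoP` record (global instance `B6Prop26ReachTransplant.instDecidableEqPBond`)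
while the chain's slice objects (`GaugeSlice`, `ιA`, `rGrad`, `sliceFn`, `anExt`) are stated in `B15Prop1IntrinsicOfFun`∕`B15Prop1GradientFromNearValue`
over the CLASSICAL instance.  DEVICE (no attribute touched, no instance declared): every theorem binds `[hdec : ∀ j, DecidableEq (PBond P j)]` with the
propositional pin `hcl : hdec = fun _ a b => Classical.propDecidable (a = b)` (a consumer passes `hcl := Subsingleton.elim _ _`); each proof is
`subst hcl; exact <classical-instance theorem> …`.

WHAT THIS FILE PROVES (no `sorry`, no definition, no `… : Prop` fact; axioms standard):
* §1 ★★ `exists_domain_prop1Printed_lfVarOn_std_su2_box_intrinsic_analytic_ofRecordFamily` — p527900's endpoint with the background, the averaging,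
  the class and `M₁` INDEXED BY THE INSTANCE (letters (J1), (L2) + `hsm`∕`hγle`, (L3), `hreg i`, structure); ★★ `…_ofRecordFamily_ofNearValue` —
  p538229 §3's endpoint likewise ((L3) replaced by (Vn) + `hfar` + `0 < k i` + `hcJ'`).
* §2 ★★★ `exists_domain_prop1Printed_lfVarOn_std_su2_box_intrinsic_analytic_atZSeqCoPRecord` and ★★★ `…_atZSeqCoPRecord_ofNearValue` —
  `∃ a₁ > 0, B15.Prop1Printed (lfVarOn su2Chart fun i => InstOn.std (Node00.bgMSCoPOfRecord F 2 ν Kt (k i) (maxDomT ν.M₁ (Z i))) ν.M₁ (Z i) (Λ i)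
  (k i) (M i) (a₁ i) (anExt …))` from (J1), (L2) and [(L3) | (Vn) + `hfar` + `0 < k i` + `hcJ'`], structure and the instance pin — `hreg` DISCHARGED.
* §3 ★★★ `…_atZSeqCoPRecordTop` and ★★★ `…_atZSeqCoPRecordTop_ofNearValue` — the same at `Node00.bgMSCoPOfRecordAt F 2 ν Kt (k i) (Z i) (maxDomT ν.M₁ (Z i))`
  (support print's `Ω₀ = Z`).

HONEST SCOPE.  Count-neutral: a located point on the lineage's own object + its by-name repair; (J1)∕(L2) are NODE 00's ([15] Thm 1 ∕ Prop. 9; [IV]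
p. 193; [LF-II] pp. 357–359), (Vn) is NODE 00's [15] Thm 1 (8) in general-sequence form — NONE proved here; NOT a discharge of N12; nothing continuum ∕
OS ∕ mass-gap ∕ Clay.
-/

noncomputable section

open Set Finset Metric
open scoped BigOperators Matrix RealInnerProductSpace Real InnerProductSpace

namespace Literature.MathematicalPhysics.QuantumFieldTheory.Balaban1983to89.B15Prop1AtZSequenceRecord

open B15DeterminingSets GaugeField B16Sect1Backgrounds B15Prop1Carrier B8Eq17ClassAkV1
open B15Prop1SliceTaylorCalculus B15Prop1LocalLettersOfFun B15Prop1IntrinsicOfFun B15Prop1IntrinsicOfRecord B15Prop1GradientFromNearValue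
open B15Prop1AnalyticExtClause (cplxVec cplxSlice anExt)
open B15Prop1ChartCalculusSU2 (E3)
open T4CubeChartGnomonic (SU2)
open B15Prop1ChartSU2 (su2Chart)
open B15Prop1SliceCoordinates (GaugeSlice ιA freeBonds)
open T4AxialGaugeSmallField (castSite boxPlaqs)
open B6BondElimination (unitVec)
open B16Eq18Proof (box)
open B15Extension193 (extend)
open B15ShellGauge193 (shellGauge)
open B5Bounds167Lattice (formDk ofRealCfg)
open B14.Eq213DetSet B14.Eq216Concrete B15Sect1Instances B15Eq177GaugeInvariance B15Eq177ValueInvariance B15Eq177ValueInvarianceCoDiv B16Sect1Wilson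
open B14.Eq22Determines (blockIter)
open Literature.MathematicalPhysics.QuantumFieldTheory.BalabanImbrieJaffe1984to88.BIJ85Eq453GaugeField
open T4Continuum

/-! ## §1 The record endpoints with a PER-INSTANCE background `Node00.bgOfRecord (av i) (reg i)` (any gauge-invariant classes) -/

section Family

open Classical

variable {P : Params}

/-- ★★ **PROPOSITION 1 [IV] WITH ITS ANALYTIC-EXTENSION CLAUSE AT NODE 00'S SOLUTION MAPS OF RECORD, ONE BACKGROUND PER INSTANCE** — the endpoint
`B15Prop1IntrinsicOfRecord.exists_domain_prop1Printed_lfVarOn_std_su2_box_intrinsic_analytic_ofRecord` (p527900) with the averaging `av i`, the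
gauge-invariant class `reg i` (`hreg i`) and the cube letter `M₁ i` INDEXED BY THE INSTANCE `i` (print applies Proposition 1 region by region: the
(1.74) background of the instance `(Z, Λ, k)` is the (2.12) solution map for `Z`'s own maximal sequence, (2.13) [III] — §2), from (J1) `hGj`, (L2)
`hlead` + `hsm`∕`hγle`, (L3) `hJ`, `k i ≤ m + K`, structure and the instance pin `hcl`.  Same proof as p527900 (`…_ofFun_intrinsic_analytic` with
`f i := fun177std (bgOfRecord (av i) (reg i)) (M₁ i) (Z i) (k i)`, p. 194's invariance sentence = `fun177std_bgOfRecord_gaugeAct`).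
[cite: Balaban1989LargeFieldI, Prop. 1 (1.77)–(1.78) p.194 (incl. the last clause), (1.74) p.192, p.193; Balaban1989LargeFieldII, (1.7)–(1.9) p.358,
(1.11)–(1.13) p.359; Balaban1988Convergent, (2.12)–(2.13) pp.256–257; Balaban1985Variational, (2),(5),(6) p.278, Prop. 9 p.309] -/
theorem exists_domain_prop1Printed_lfVarOn_std_su2_box_intrinsic_analytic_ofRecordFamily (hd3 : 3 ≤ P.d) (h0 : 0 < P.d) {ι : Type}
    -- bond decidability: the ambient instance, pinned propositionally to the chain's classical one (`hcl := Subsingleton.elim _ _`)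
    [hdec : ∀ j, DecidableEq (PBond P j)] (hcl : hdec = fun _ a b => Classical.propDecidable (a = b))
    (av : ι → ∀ j, Averaging P j SU2) (reg : ι → Set (GaugeField P 0 SU2))
    (hreg : ∀ i (w : GaugeTransf P 0 SU2) (U : GaugeField P 0 SU2), U ∈ reg i → gaugeAct w U ∈ reg i)
    (M₁ : ι → ℕ) (Z Λ : ι → Set (Site P 0)) (k : ι → ℕ) (M : ι → ℝ) (hk : ∀ i, k i ≤ P.m + P.K)
    (eR : ι → ℝ) (heR : ∀ i, 0 < eR i)
    (T : ∀ i, Finset (PBond P (k i)))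
    (lo hi : ι → Fin P.d → ℤ) (n : ι → ℕ) (hn : ∀ i κ, hi i κ ≤ lo i κ + n i) (hN : ∀ i, n i + 2 < P.sitesPerDir (k i))
    (hbox : ∀ i, pts (k i) (Λ i) = (castSite '' Set.Icc (lo i) (hi i) : Set (Site P (k i))))
    (hZ : ∀ i, (boxPlaqs (lo i - 1) (hi i + 1) : Set (Plaq P (k i))) ⊆ plaqsInside (pts (k i) (Z i)))
    (hTG0 : ∀ i, T i = (box (fun κ => (hi i κ - lo i κ + 1).toNat) (lo i)).image fun x =>
      (⟨castSite (x - unitVec ⟨0, h0⟩), ⟨0, h0⟩⟩ : PBond P (k i)))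
    (hN5 : ∀ i κ, ((hi i κ - lo i κ + 1).toNat : ℤ) + 5 < P.sitesPerDir (k i))
    (K : ι → ℕ) (hK1 : ∀ i, 1 ≤ K i) (hKn : ∀ i κ, (hi i κ - lo i κ + 1).toNat ≤ K i)
    (ext : ∀ i, GaugeField P (k i) SU2 → GaugeField P (k i) SU2)
    (hext : ∀ i Vk, ext i Vk = extend (pts (k i) (Λ i)) (shellGauge Vk (lo i) (hi i)) Vk)
    (hlohi : ∀ i, lo i ≤ hi i)
    {γ cJ bx : ℝ} (hγ : 0 < γ) (hcJ : 0 ≤ cJ) (hbx : 0 ≤ bx)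
    (hbxM : ∀ i, 12 * (P.d : ℝ) * ((n i : ℝ) + 2) ^ 2 ≤ bx * (M i) ^ 2)
    {Cerr R 𝓐 : ι → ℝ} (hM : ∀ i, 1 ≤ (M i)) (hR : ∀ i, 0 < R i) (h𝓐 : ∀ i, 0 ≤ 𝓐 i)
    (n' : ι → ℕ) (hn' : ∀ i, 1 ≤ n' i)
    -- (J1) the JOINT holomorphic extension of print's function in the datum perturbation and the field
    (hGj : ∀ i Vk, PlaqSmallOn (plaqsInside (pts (k i) (Z i ∩ (Λ i)ᶜ))) (eR i) Vk →
      ∃ 𝒢 : VecField P (k i) (EuclideanSpace ℂ (Fin 3)) × VecField P (k i) (EuclideanSpace ℂ (Fin 3)) → ℂ,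
        DifferentiableOn ℂ 𝒢 (ball 0 (R i)) ∧
        (∀ z ∈ ball (0 : VecField P (k i) (EuclideanSpace ℂ (Fin 3)) × VecField P (k i) (EuclideanSpace ℂ (Fin 3))) (R i), ‖𝒢 z‖ ≤ 𝓐 i) ∧
        ∀ p B' : VecField P (k i) E3, ‖p‖ < R i → ‖B'‖ < R i →
          𝒢 (cplxVec p, cplxVec B') =
            ((fun177std (Node00.bgOfRecord (av i) (reg i)) (M₁ i) (Z i) (k i) (expMul su2Chart B' (ext i (expMul su2Chart p Vk))) : ℝ) : ℂ))
    -- (L2) (1.7)–(1.9) p.358 for the Hessian of the slice function at `0`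
    (hlead : ∀ i Vk, PlaqSmallOn (plaqsInside (pts (k i) (Z i ∩ (Λ i)ᶜ))) (eR i) Vk →
      ∀ X : GaugeSlice (pts (k i) (Λ i)) (T i) E3,
      |⟪X, (fderiv ℝ (rGrad (pts (k i) (Λ i)) (T i)
              (sliceFn (pts (k i) (Λ i)) (T i) (fun177std (Node00.bgOfRecord (av i) (reg i)) (M₁ i) (Z i) (k i)) (ext i Vk))) 0) X⟫ -
          ∑ a : Fin 3, formDk (n' i) (fun _ : Fin P.d => P.sitesPerDir (k i))
            (ofRealCfg (fun _ : Fin P.d => P.sitesPerDir (k i)) fun j =>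
              ιA (pts (k i) (Λ i)) (T i) X ⟨j.1, j.2⟩ a)| ≤ Cerr i * ‖X‖ ^ 2)
    (hsm : ∀ i, Cerr i ≤ (4 / Real.pi ^ 2) ^ (P.d + 2) / (2 * (3 * (K i : ℝ) ^ 2 + 2 * (K i : ℝ) ^ 4)))
    (hγle : ∀ i, γ / (M i) ^ 5 ≤ (4 / Real.pi ^ 2) ^ (P.d + 2) / (2 * (3 * (K i : ℝ) ^ 2 + 2 * (K i : ℝ) ^ 4)))
    -- (L3) p.359: the gradient at `0` is small at regular data
    (hJ : ∀ i ε Vk, 0 < ε → ε ≤ eR i → PlaqSmallOn (plaqsInside (pts (k i) (Z i ∩ (Λ i)ᶜ))) ε Vk →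
      ‖rGrad (pts (k i) (Λ i)) (T i)
        (sliceFn (pts (k i) (Λ i)) (T i) (fun177std (Node00.bgOfRecord (av i) (reg i)) (M₁ i) (Z i) (k i)) (ext i Vk)) 0‖ ≤ cJ * ε)
    : ∃ a₁ : ι → ℝ, (∀ i, 0 < a₁ i) ∧
      B15.Prop1Printed (lfVarOn su2Chart fun i => InstOn.std (Node00.bgOfRecord (av i) (reg i)) (M₁ i) (Z i) (Λ i) (k i) (M i) (a₁ i)
        (anExt (pts (k i) (Λ i)) (T i) (fun177std (Node00.bgOfRecord (av i) (reg i)) (M₁ i) (Z i) (k i)) (ext i)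
          (min (1 / 2) (min (R i / 8) (γ / (M i) ^ 5 * (R i / 2) ^ 2 / (48 * (4 * 𝓐 i / R i + 1))))))) := by
  subst hcl
  exact exists_domain_prop1Printed_lfVarOn_ofFun_intrinsic_analytic hd3 h0 Z Λ k M
    (fun i => fun177std (Node00.bgOfRecord (av i) (reg i)) (M₁ i) (Z i) (k i))
    (fun i u V => fun177std_bgOfRecord_gaugeAct (av i) (hreg i) (M₁ i) (Z i) (hk i) u V) eR heR T lo hi n hn hN hbox hZ hTG0 hN5 K hK1 hKn
    ext hext hlohi hγ hcJ hbx hbxM hM hR h𝓐 n' hn' hGj hlead hsm hγle hJ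

/-- ★★ **THE SAME WITH THE GRADIENT LETTER (L3) REPLACED BY THE NEAR-FIELD VALUE LETTER (Vn), ONE BACKGROUND PER INSTANCE** — the endpoint
`B15Prop1GradientFromNearValue.exists_domain_prop1Printed_lfVarOn_std_su2_box_intrinsic_analytic_ofRecord_ofNearValue` (p538229 §3) with `av i`,
`reg i` (`hreg i`), `M₁ i` indexed by the instance: (J1) `hGj`, (L2) `hlead` + `hsm`∕`hγle`, (Vn) `hVn` — the near-field part
`Σ_{p ∈ plaqsOf Ω₁(Z)} (1 − Re tr U_{k,Z}(ext V_k)(∂p)) ≤ cA·ε²` at `ε`-regular data ([IV] p. 193 ll. 17–20 summed) — `hcJ'`, the geometric letter `hfar`,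
`0 < k i ≤ m + K`, structure, `hcl`.  Same proof as p538229 §3 (`hJ_of_nearValue` + `fun177std_dichotomy`, instance by instance).
[cite: Balaban1989LargeFieldI, Prop. 1 (1.77)–(1.78) p.194 (incl. the last clause), (1.74) p.192, p.193; Balaban1989LargeFieldII, (1.7)–(1.9) p.358,
(1.11) p.358, (1.12)–(1.13) p.359; Balaban1988Convergent, (2.12)–(2.13) pp.256–257; Balaban1985Variational, (2),(5),(6) p.278, Thm 1 (8) p.279, Prop. 9 p.309] -/
theorem exists_domain_prop1Printed_lfVarOn_std_su2_box_intrinsic_analytic_ofRecordFamily_ofNearValue (hd3 : 3 ≤ P.d) (h0 : 0 < P.d) {ι : Type}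
    [hdec : ∀ j, DecidableEq (PBond P j)] (hcl : hdec = fun _ a b => Classical.propDecidable (a = b))
    (av : ι → ∀ j, Averaging P j SU2) (reg : ι → Set (GaugeField P 0 SU2))
    (hreg : ∀ i (w : GaugeTransf P 0 SU2) (U : GaugeField P 0 SU2), U ∈ reg i → gaugeAct w U ∈ reg i)
    (M₁ : ι → ℕ) (Z Λ : ι → Set (Site P 0)) (k : ι → ℕ) (M : ι → ℝ) (hk0 : ∀ i, 0 < k i) (hk : ∀ i, k i ≤ P.m + P.K)
    (eR : ι → ℝ) (heR : ∀ i, 0 < eR i)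
    (T : ∀ i, Finset (PBond P (k i)))
    (lo hi : ι → Fin P.d → ℤ) (n : ι → ℕ) (hn : ∀ i κ, hi i κ ≤ lo i κ + n i) (hN : ∀ i, n i + 2 < P.sitesPerDir (k i))
    (hbox : ∀ i, pts (k i) (Λ i) = (castSite '' Set.Icc (lo i) (hi i) : Set (Site P (k i))))
    (hZ : ∀ i, (boxPlaqs (lo i - 1) (hi i + 1) : Set (Plaq P (k i))) ⊆ plaqsInside (pts (k i) (Z i)))
    (hTG0 : ∀ i, T i = (box (fun κ => (hi i κ - lo i κ + 1).toNat) (lo i)).image fun x =>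
      (⟨castSite (x - unitVec ⟨0, h0⟩), ⟨0, h0⟩⟩ : PBond P (k i)))
    (hN5 : ∀ i κ, ((hi i κ - lo i κ + 1).toNat : ℤ) + 5 < P.sitesPerDir (k i))
    (K : ι → ℕ) (hK1 : ∀ i, 1 ≤ K i) (hKn : ∀ i κ, (hi i κ - lo i κ + 1).toNat ≤ K i)
    (ext : ∀ i, GaugeField P (k i) SU2 → GaugeField P (k i) SU2)
    (hext : ∀ i Vk, ext i Vk = extend (pts (k i) (Λ i)) (shellGauge Vk (lo i) (hi i)) Vk)
    (hlohi : ∀ i, lo i ≤ hi i)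
    {γ cJ bx : ℝ} (hγ : 0 < γ) (hcJ : 0 ≤ cJ) (hbx : 0 ≤ bx)
    (hbxM : ∀ i, 12 * (P.d : ℝ) * ((n i : ℝ) + 2) ^ 2 ≤ bx * (M i) ^ 2)
    {Cerr R 𝓐 : ι → ℝ} (hM : ∀ i, 1 ≤ (M i)) (hR : ∀ i, 0 < R i) (h𝓐 : ∀ i, 0 ≤ 𝓐 i)
    (n' : ι → ℕ) (hn' : ∀ i, 1 ≤ n' i)
    -- (J1) the JOINT holomorphic extension of print's function in the datum perturbation and the field
    (hGj : ∀ i Vk, PlaqSmallOn (plaqsInside (pts (k i) (Z i ∩ (Λ i)ᶜ))) (eR i) Vk →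
      ∃ 𝒢 : VecField P (k i) (EuclideanSpace ℂ (Fin 3)) × VecField P (k i) (EuclideanSpace ℂ (Fin 3)) → ℂ,
        DifferentiableOn ℂ 𝒢 (ball 0 (R i)) ∧
        (∀ z ∈ ball (0 : VecField P (k i) (EuclideanSpace ℂ (Fin 3)) × VecField P (k i) (EuclideanSpace ℂ (Fin 3))) (R i), ‖𝒢 z‖ ≤ 𝓐 i) ∧
        ∀ p B' : VecField P (k i) E3, ‖p‖ < R i → ‖B'‖ < R i →
          𝒢 (cplxVec p, cplxVec B') =
            ((fun177std (Node00.bgOfRecord (av i) (reg i)) (M₁ i) (Z i) (k i) (expMul su2Chart B' (ext i (expMul su2Chart p Vk))) : ℝ) : ℂ))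
    -- (L2) (1.7)–(1.9) p.358 for the Hessian of the slice function at `0`
    (hlead : ∀ i Vk, PlaqSmallOn (plaqsInside (pts (k i) (Z i ∩ (Λ i)ᶜ))) (eR i) Vk →
      ∀ X : GaugeSlice (pts (k i) (Λ i)) (T i) E3,
      |⟪X, (fderiv ℝ (rGrad (pts (k i) (Λ i)) (T i)
              (sliceFn (pts (k i) (Λ i)) (T i) (fun177std (Node00.bgOfRecord (av i) (reg i)) (M₁ i) (Z i) (k i)) (ext i Vk))) 0) X⟫ -
          ∑ a : Fin 3, formDk (n' i) (fun _ : Fin P.d => P.sitesPerDir (k i))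
            (ofRealCfg (fun _ : Fin P.d => P.sitesPerDir (k i)) fun j =>
              ιA (pts (k i) (Λ i)) (T i) X ⟨j.1, j.2⟩ a)| ≤ Cerr i * ‖X‖ ^ 2)
    (hsm : ∀ i, Cerr i ≤ (4 / Real.pi ^ 2) ^ (P.d + 2) / (2 * (3 * (K i : ℝ) ^ 2 + 2 * (K i : ℝ) ^ 4)))
    (hγle : ∀ i, γ / (M i) ^ 5 ≤ (4 / Real.pi ^ 2) ^ (P.d + 2) / (2 * (3 * (K i : ℝ) ^ 2 + 2 * (K i : ℝ) ^ 4)))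
    -- the geometric letter: the k-blocks over the bonds meeting `Λ^{(k)}` lie inside `Ω₁(Z)` (print: `Λ` deep inside `Z`)
    (hfar : ∀ i (b : PBond P 0), b.src ∉ maxDomT (M₁ i) (Z i) 1 → (⟨blockIter (k i) b.src, b.dir⟩ : PBond P (k i)) ∉ bondsOf (pts (k i) (Λ i)))
    -- (Vn) the NEAR-FIELD part of (1.77) at the extended regular datum is small (replaces (L3))
    {cA : ℝ}
    (hVn : ∀ i ε Vk, 0 < ε → ε ≤ eR i → PlaqSmallOn (plaqsInside (pts (k i) (Z i ∩ (Λ i)ᶜ))) ε Vk →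
      wilsonLoc ((plaqsOf (maxDomT (M₁ i) (Z i) 1)).indicator fun _ => (1 : ℝ))
        (bgKZstd (Node00.bgOfRecord (av i) (reg i)) (M₁ i) (Z i) (k i) (ext i Vk)) ≤ cA * ε ^ 2)
    (hcJ' : ∀ i, 2 * cA * eR i / R i + 4 * 𝓐 i / (R i * eR i) ≤ cJ)
    : ∃ a₁ : ι → ℝ, (∀ i, 0 < a₁ i) ∧
      B15.Prop1Printed (lfVarOn su2Chart fun i => InstOn.std (Node00.bgOfRecord (av i) (reg i)) (M₁ i) (Z i) (Λ i) (k i) (M i) (a₁ i)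
        (anExt (pts (k i) (Λ i)) (T i) (fun177std (Node00.bgOfRecord (av i) (reg i)) (M₁ i) (Z i) (k i)) (ext i)
          (min (1 / 2) (min (R i / 8) (γ / (M i) ^ 5 * (R i / 2) ^ 2 / (48 * (4 * 𝓐 i / R i + 1))))))) := by
  subst hcl
  exact exists_domain_prop1Printed_lfVarOn_ofFun_intrinsic_analytic hd3 h0 Z Λ k M
    (fun i => fun177std (Node00.bgOfRecord (av i) (reg i)) (M₁ i) (Z i) (k i))
    (fun i u V => fun177std_bgOfRecord_gaugeAct (av i) (hreg i) (M₁ i) (Z i) (hk i) u V) eR heR T lo hi n hn hN hbox hZ hTG0 hN5 K hK1 hKn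
    ext hext hlohi hγ hcJ hbx hbxM hM hR h𝓐 n' hn' hGj hlead hsm hγle
    (hJ_of_nearValue Z Λ k (fun i => fun177std (Node00.bgOfRecord (av i) (reg i)) (M₁ i) (Z i) (k i))
      (fun i V => wilsonLoc ((plaqsOf (maxDomT (M₁ i) (Z i) 1)).indicator fun _ => (1 : ℝ))
        (bgKZstd (Node00.bgOfRecord (av i) (reg i)) (M₁ i) (Z i) (k i) V))
      (fun _ _ => wilsonLoc_nonneg _ _ fun p => Set.indicator_nonneg (fun _ _ => zero_le_one) p) eR heR T ext hR hGj
      (fun i Vk _ => fun177std_dichotomy (av i) (reg i) (M₁ i) (hk0 i) (hk i) (T i) (hfar i) (ext i Vk)) hVn hcJ')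

end Family

/-! ## §2 At print's (1.74) object in NODE 00's support convention: the v1.5 constructor of record AT `Z`'s OWN maximal sequence (2.13), `Node00.bgMSCoPOfRecord F 2 ν Kt k (maxDomT ν.M₁ Z)` -/

section ZSequenceHull

open Classical

/-- ★★★ **PROPOSITION 1 [IV] WITH ITS ANALYTIC-EXTENSION CLAUSE AT PRINT'S (1.74) OBJECT `U_{k,Z} = U(𝔹_k(Z), ·)`** — per instance `i` the background
is NODE 00's v1.5 background constructor OF RECORD applied to `Z`'s maximal sequence (2.13): `Node00.bgMSCoPOfRecord F 2 ν Kt (k i) (maxDomT ν.M₁ (Z i))`,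
i.e. the (2.12) solution map over [15]'s class (2) `𝔘_k({Ω_n(Z)}, εreg)` read in NODE 00's SUPPORT CONVENTION — scale `0` on the support of record
`Node00.suppDomOfRecord F ν Kt (maxDomT ν.M₁ Z) = hullD … ν.M₁ 1 (Ω₁(Z))` (*«Ω₁, or rather a small neighborhood of Ω₁ including a layer of M₁-cubes»*,
[III] p. 255), scales `1 ≤ n ≤ k` on `Ω_n(Z)` ((1.7) ∧ (1.9) on the plaquettes ∕ bonds meeting the domain) — the SAME sequence whose determining set
`𝔹_k(Z) = genSet (maxDomT ν.M₁ Z) k` carries the constraints, as print and NODE 00's `VariationalThm1RegSep…` facts have it (module docstring,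
LOCATED-CLASS); this is the shape at which a general-sequence edition of `Node00.VariationalThm1RegSepCoP7M` applies verbatim (its
`UbgMSCoPOfRecord`).  §3 is the twin with print's full top domain `Ω₀ = Z` as support; the two differ only by the class's scale-`0` clause on the
PINNED collar `Z ∖ hull(Ω₁(Z))` (a feasibility condition on the datum; [III] (1.12) «U = V₀ on Ω₁ᶜ»).  The class invariance is DISCHARGED
(`B15Eq177ValueInvarianceCoDiv.gaugeAct_mem_regMSCoPOfRecord`, [15] p. 278 *«The space 𝔘_k({Ω_j}, ε₀) is gauge invariant»*).  WHAT A CONSUMER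
SUPPLIES: (J1) `hGj`, (L2) `hlead` + `hsm`∕`hγle`, (L3) `hJ` about `A ∘ U_{k,Z}` at THIS background, `k i ≤ m + K`, structure, `hcl := Subsingleton.elim _ _`.
[cite: Balaban1989LargeFieldI, (1.74) p.192, Prop. 1 (1.77)–(1.78) p.194 (incl. the last clause), p.193; Balaban1988Convergent, p.255, (2.12)–(2.13) pp.256–257;
Balaban1985Variational, (2),(5),(6) p.278, Prop. 9 p.309; Balaban1989LargeFieldII, (1.7)–(1.9) p.358, (1.11)–(1.13) p.359] -/
theorem exists_domain_prop1Printed_lfVarOn_std_su2_box_intrinsic_analytic_atZSeqCoPRecord {F : T4Family} (ν : Node00.Stage7Numerics)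
    (Kt : ℕ) (hd3 : 3 ≤ (F.P Kt).d) (h0 : 0 < (F.P Kt).d) {ι : Type}
    -- bond decidability: the consumer's instance, pinned propositionally to the chain's classical one (`hcl := Subsingleton.elim _ _`)
    [hdec : ∀ j, DecidableEq (PBond (F.P Kt) j)] (hcl : hdec = fun _ a b => Classical.propDecidable (a = b))
    (Z Λ : ι → Set (Site (F.P Kt) 0)) (k : ι → ℕ) (M : ι → ℝ) (hk : ∀ i, k i ≤ (F.P Kt).m + (F.P Kt).K)
    (eR : ι → ℝ) (heR : ∀ i, 0 < eR i)
    (T : ∀ i, Finset (PBond (F.P Kt) (k i)))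
    (lo hi : ι → Fin (F.P Kt).d → ℤ) (n : ι → ℕ) (hn : ∀ i κ, hi i κ ≤ lo i κ + n i) (hN : ∀ i, n i + 2 < (F.P Kt).sitesPerDir (k i))
    (hbox : ∀ i, pts (k i) (Λ i) = (castSite '' Set.Icc (lo i) (hi i) : Set (Site (F.P Kt) (k i))))
    (hZ : ∀ i, (boxPlaqs (lo i - 1) (hi i + 1) : Set (Plaq (F.P Kt) (k i))) ⊆ plaqsInside (pts (k i) (Z i)))
    (hTG0 : ∀ i, T i = (box (fun κ => (hi i κ - lo i κ + 1).toNat) (lo i)).image fun x =>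
      (⟨castSite (x - unitVec ⟨0, h0⟩), ⟨0, h0⟩⟩ : PBond (F.P Kt) (k i)))
    (hN5 : ∀ i κ, ((hi i κ - lo i κ + 1).toNat : ℤ) + 5 < (F.P Kt).sitesPerDir (k i))
    (K : ι → ℕ) (hK1 : ∀ i, 1 ≤ K i) (hKn : ∀ i κ, (hi i κ - lo i κ + 1).toNat ≤ K i)
    (ext : ∀ i, GaugeField (F.P Kt) (k i) SU2 → GaugeField (F.P Kt) (k i) SU2)
    (hext : ∀ i Vk, ext i Vk = extend (pts (k i) (Λ i)) (shellGauge Vk (lo i) (hi i)) Vk)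
    (hlohi : ∀ i, lo i ≤ hi i)
    {γ cJ bx : ℝ} (hγ : 0 < γ) (hcJ : 0 ≤ cJ) (hbx : 0 ≤ bx)
    (hbxM : ∀ i, 12 * ((F.P Kt).d : ℝ) * ((n i : ℝ) + 2) ^ 2 ≤ bx * (M i) ^ 2)
    {Cerr R 𝓐 : ι → ℝ} (hM : ∀ i, 1 ≤ (M i)) (hR : ∀ i, 0 < R i) (h𝓐 : ∀ i, 0 ≤ 𝓐 i)
    (n' : ι → ℕ) (hn' : ∀ i, 1 ≤ n' i)
    -- (J1) the JOINT holomorphic extension of print's function in the datum perturbation and the field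
    (hGj : ∀ i Vk, PlaqSmallOn (plaqsInside (pts (k i) (Z i ∩ (Λ i)ᶜ))) (eR i) Vk →
      ∃ 𝒢 : VecField (F.P Kt) (k i) (EuclideanSpace ℂ (Fin 3)) × VecField (F.P Kt) (k i) (EuclideanSpace ℂ (Fin 3)) → ℂ,
        DifferentiableOn ℂ 𝒢 (ball 0 (R i)) ∧
        (∀ z ∈ ball (0 : VecField (F.P Kt) (k i) (EuclideanSpace ℂ (Fin 3)) × VecField (F.P Kt) (k i) (EuclideanSpace ℂ (Fin 3))) (R i), ‖𝒢 z‖ ≤ 𝓐 i) ∧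
        ∀ p B' : VecField (F.P Kt) (k i) E3, ‖p‖ < R i → ‖B'‖ < R i →
          𝒢 (cplxVec p, cplxVec B') =
            ((fun177std (Node00.bgMSCoPOfRecord F 2 ν Kt (k i) (maxDomT ν.M₁ (Z i))) ν.M₁ (Z i) (k i)
              (expMul su2Chart B' (ext i (expMul su2Chart p Vk))) : ℝ) : ℂ))
    -- (L2) (1.7)–(1.9) p.358 for the Hessian of the slice function at `0`
    (hlead : ∀ i Vk, PlaqSmallOn (plaqsInside (pts (k i) (Z i ∩ (Λ i)ᶜ))) (eR i) Vk →
      ∀ X : GaugeSlice (pts (k i) (Λ i)) (T i) E3,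
      |⟪X, (fderiv ℝ (rGrad (pts (k i) (Λ i)) (T i)
              (sliceFn (pts (k i) (Λ i)) (T i)
                (fun177std (Node00.bgMSCoPOfRecord F 2 ν Kt (k i) (maxDomT ν.M₁ (Z i))) ν.M₁ (Z i) (k i)) (ext i Vk))) 0) X⟫ -
          ∑ a : Fin 3, formDk (n' i) (fun _ : Fin (F.P Kt).d => (F.P Kt).sitesPerDir (k i))
            (ofRealCfg (fun _ : Fin (F.P Kt).d => (F.P Kt).sitesPerDir (k i)) fun j =>
              ιA (pts (k i) (Λ i)) (T i) X ⟨j.1, j.2⟩ a)| ≤ Cerr i * ‖X‖ ^ 2)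
    (hsm : ∀ i, Cerr i ≤ (4 / Real.pi ^ 2) ^ ((F.P Kt).d + 2) / (2 * (3 * (K i : ℝ) ^ 2 + 2 * (K i : ℝ) ^ 4)))
    (hγle : ∀ i, γ / (M i) ^ 5 ≤ (4 / Real.pi ^ 2) ^ ((F.P Kt).d + 2) / (2 * (3 * (K i : ℝ) ^ 2 + 2 * (K i : ℝ) ^ 4)))
    -- (L3) p.359: the gradient at `0` is small at regular data
    (hJ : ∀ i ε Vk, 0 < ε → ε ≤ eR i → PlaqSmallOn (plaqsInside (pts (k i) (Z i ∩ (Λ i)ᶜ))) ε Vk →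
      ‖rGrad (pts (k i) (Λ i)) (T i)
        (sliceFn (pts (k i) (Λ i)) (T i)
          (fun177std (Node00.bgMSCoPOfRecord F 2 ν Kt (k i) (maxDomT ν.M₁ (Z i))) ν.M₁ (Z i) (k i)) (ext i Vk)) 0‖ ≤ cJ * ε)
    : ∃ a₁ : ι → ℝ, (∀ i, 0 < a₁ i) ∧
      B15.Prop1Printed (lfVarOn su2Chart fun i =>
        InstOn.std (Node00.bgMSCoPOfRecord F 2 ν Kt (k i) (maxDomT ν.M₁ (Z i))) ν.M₁ (Z i) (Λ i) (k i) (M i) (a₁ i)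
          (anExt (pts (k i) (Λ i)) (T i)
            (fun177std (Node00.bgMSCoPOfRecord F 2 ν Kt (k i) (maxDomT ν.M₁ (Z i))) ν.M₁ (Z i) (k i)) (ext i)
            (min (1 / 2) (min (R i / 8) (γ / (M i) ^ 5 * (R i / 2) ^ 2 / (48 * (4 * 𝓐 i / R i + 1))))))) := by
  subst hcl
  exact exists_domain_prop1Printed_lfVarOn_ofFun_intrinsic_analytic hd3 h0 Z Λ k M
    (fun i => fun177std (Node00.bgMSCoPOfRecord F 2 ν Kt (k i) (maxDomT ν.M₁ (Z i))) ν.M₁ (Z i) (k i))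
    (fun i u V => fun177std_bgOfRecord_gaugeAct (Node00.avOfRecord F 2 Kt)
      (gaugeAct_mem_regMSCoPOfRecord ν Kt (k i) (maxDomT ν.M₁ (Z i))) ν.M₁ (Z i) (hk i) u V)
    eR heR T lo hi n hn hN hbox hZ hTG0 hN5 K hK1 hKn ext hext hlohi hγ hcJ hbx hbxM hM hR h𝓐 n' hn' hGj hlead hsm hγle hJ

/-- ★★★ **PROPOSITION 1 [IV] WITH ITS ANALYTIC-EXTENSION CLAUSE AT PRINT'S (1.74) OBJECT, WITH THE GRADIENT LETTER (L3) REPLACED BY THE NEAR-FIELD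
VALUE LETTER (Vn)** — per instance the background `Node00.bgMSCoPOfRecord F 2 ν Kt (k i) (maxDomT ν.M₁ (Z i))` (NODE 00's constructor of record at
`Z`'s own maximal sequence, support `hull(Ω₁(Z))`; class invariance DISCHARGED by `gaugeAct_mem_regMSCoPOfRecord`); SUPERSEDES
`B15Prop1GradientFromNearValueAtCoPRecord.…_atCoPRecord_ofNearValue` (p540333 §1; same letters, background of the RUN's class) for consumption.  WHAT A
CONSUMER SUPPLIES: (J1) `hGj`, (L2) `hlead` + `hsm`∕`hγle`, (Vn) `hVn : Σ_{p ∈ plaqsOf Ω₁(Z)} (1 − Re tr U_{k,Z}(ext V_k)(∂p)) ≤ cA·ε²` at `ε`-regular data —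
print's (8) for `U_{k,Z}` ([IV] p. 193 ll. 17–20; at this background = [15] Thm 1 (8) for the admissible sequence `maxDomT ν.M₁ Z`, LOCATED-GENFORM of the
module docstring) via `B15Prop1GradientFromNearValueAtCoPRecord.nearValue_le_of_plaqSmallOn` — `hcJ' : 2cA·eR∕R + 4𝓐∕(R·eR) ≤ cJ`, the geometric letter
`hfar` (`…AtCoPRecord.far_letter_of_box`), `0 < k i ≤ m + K`, structure, `hcl := Subsingleton.elim _ _`.
[cite: Balaban1989LargeFieldI, (1.74) p.192, Prop. 1 (1.77)–(1.78) p.194 (incl. the last clause), p.193; Balaban1988Convergent, p.255, (2.12)–(2.13) pp.256–257;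
Balaban1985Variational, (2),(5),(6) p.278, Thm 1 (8) p.279, Prop. 9 p.309; Balaban1989LargeFieldII, (1.7)–(1.9) p.358, (1.11) p.358, (1.12)–(1.13) p.359] -/
theorem exists_domain_prop1Printed_lfVarOn_std_su2_box_intrinsic_analytic_atZSeqCoPRecord_ofNearValue {F : T4Family}
    (ν : Node00.Stage7Numerics) (Kt : ℕ) (hd3 : 3 ≤ (F.P Kt).d) (h0 : 0 < (F.P Kt).d) {ι : Type}
    [hdec : ∀ j, DecidableEq (PBond (F.P Kt) j)] (hcl : hdec = fun _ a b => Classical.propDecidable (a = b))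
    (Z Λ : ι → Set (Site (F.P Kt) 0)) (k : ι → ℕ) (M : ι → ℝ) (hk0 : ∀ i, 0 < k i) (hk : ∀ i, k i ≤ (F.P Kt).m + (F.P Kt).K)
    (eR : ι → ℝ) (heR : ∀ i, 0 < eR i)
    (T : ∀ i, Finset (PBond (F.P Kt) (k i)))
    (lo hi : ι → Fin (F.P Kt).d → ℤ) (n : ι → ℕ) (hn : ∀ i κ, hi i κ ≤ lo i κ + n i) (hN : ∀ i, n i + 2 < (F.P Kt).sitesPerDir (k i))
    (hbox : ∀ i, pts (k i) (Λ i) = (castSite '' Set.Icc (lo i) (hi i) : Set (Site (F.P Kt) (k i))))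
    (hZ : ∀ i, (boxPlaqs (lo i - 1) (hi i + 1) : Set (Plaq (F.P Kt) (k i))) ⊆ plaqsInside (pts (k i) (Z i)))
    (hTG0 : ∀ i, T i = (box (fun κ => (hi i κ - lo i κ + 1).toNat) (lo i)).image fun x =>
      (⟨castSite (x - unitVec ⟨0, h0⟩), ⟨0, h0⟩⟩ : PBond (F.P Kt) (k i)))
    (hN5 : ∀ i κ, ((hi i κ - lo i κ + 1).toNat : ℤ) + 5 < (F.P Kt).sitesPerDir (k i))
    (K : ι → ℕ) (hK1 : ∀ i, 1 ≤ K i) (hKn : ∀ i κ, (hi i κ - lo i κ + 1).toNat ≤ K i)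
    (ext : ∀ i, GaugeField (F.P Kt) (k i) SU2 → GaugeField (F.P Kt) (k i) SU2)
    (hext : ∀ i Vk, ext i Vk = extend (pts (k i) (Λ i)) (shellGauge Vk (lo i) (hi i)) Vk)
    (hlohi : ∀ i, lo i ≤ hi i)
    {γ cJ bx : ℝ} (hγ : 0 < γ) (hcJ : 0 ≤ cJ) (hbx : 0 ≤ bx)
    (hbxM : ∀ i, 12 * ((F.P Kt).d : ℝ) * ((n i : ℝ) + 2) ^ 2 ≤ bx * (M i) ^ 2)
    {Cerr R 𝓐 : ι → ℝ} (hM : ∀ i, 1 ≤ (M i)) (hR : ∀ i, 0 < R i) (h𝓐 : ∀ i, 0 ≤ 𝓐 i)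
    (n' : ι → ℕ) (hn' : ∀ i, 1 ≤ n' i)
    -- (J1) the JOINT holomorphic extension of print's function in the datum perturbation and the field
    (hGj : ∀ i Vk, PlaqSmallOn (plaqsInside (pts (k i) (Z i ∩ (Λ i)ᶜ))) (eR i) Vk →
      ∃ 𝒢 : VecField (F.P Kt) (k i) (EuclideanSpace ℂ (Fin 3)) × VecField (F.P Kt) (k i) (EuclideanSpace ℂ (Fin 3)) → ℂ,
        DifferentiableOn ℂ 𝒢 (ball 0 (R i)) ∧
        (∀ z ∈ ball (0 : VecField (F.P Kt) (k i) (EuclideanSpace ℂ (Fin 3)) × VecField (F.P Kt) (k i) (EuclideanSpace ℂ (Fin 3))) (R i), ‖𝒢 z‖ ≤ 𝓐 i) ∧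
        ∀ p B' : VecField (F.P Kt) (k i) E3, ‖p‖ < R i → ‖B'‖ < R i →
          𝒢 (cplxVec p, cplxVec B') =
            ((fun177std (Node00.bgMSCoPOfRecord F 2 ν Kt (k i) (maxDomT ν.M₁ (Z i))) ν.M₁ (Z i) (k i)
              (expMul su2Chart B' (ext i (expMul su2Chart p Vk))) : ℝ) : ℂ))
    -- (L2) (1.7)–(1.9) p.358 for the Hessian of the slice function at `0`
    (hlead : ∀ i Vk, PlaqSmallOn (plaqsInside (pts (k i) (Z i ∩ (Λ i)ᶜ))) (eR i) Vk →
      ∀ X : GaugeSlice (pts (k i) (Λ i)) (T i) E3,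
      |⟪X, (fderiv ℝ (rGrad (pts (k i) (Λ i)) (T i)
              (sliceFn (pts (k i) (Λ i)) (T i)
                (fun177std (Node00.bgMSCoPOfRecord F 2 ν Kt (k i) (maxDomT ν.M₁ (Z i))) ν.M₁ (Z i) (k i)) (ext i Vk))) 0) X⟫ -
          ∑ a : Fin 3, formDk (n' i) (fun _ : Fin (F.P Kt).d => (F.P Kt).sitesPerDir (k i))
            (ofRealCfg (fun _ : Fin (F.P Kt).d => (F.P Kt).sitesPerDir (k i)) fun j =>
              ιA (pts (k i) (Λ i)) (T i) X ⟨j.1, j.2⟩ a)| ≤ Cerr i * ‖X‖ ^ 2)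
    (hsm : ∀ i, Cerr i ≤ (4 / Real.pi ^ 2) ^ ((F.P Kt).d + 2) / (2 * (3 * (K i : ℝ) ^ 2 + 2 * (K i : ℝ) ^ 4)))
    (hγle : ∀ i, γ / (M i) ^ 5 ≤ (4 / Real.pi ^ 2) ^ ((F.P Kt).d + 2) / (2 * (3 * (K i : ℝ) ^ 2 + 2 * (K i : ℝ) ^ 4)))
    -- the geometric letter: the k-blocks over the bonds meeting `Λ^{(k)}` lie inside `Ω₁(Z)` (print: `Λ` deep inside `Z`)
    (hfar : ∀ i (b : PBond (F.P Kt) 0), b.src ∉ maxDomT ν.M₁ (Z i) 1 →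
      (⟨blockIter (k i) b.src, b.dir⟩ : PBond (F.P Kt) (k i)) ∉ bondsOf (pts (k i) (Λ i)))
    -- (Vn) the NEAR-FIELD part of (1.77) at the extended regular datum is small (replaces (L3))
    {cA : ℝ}
    (hVn : ∀ i ε Vk, 0 < ε → ε ≤ eR i → PlaqSmallOn (plaqsInside (pts (k i) (Z i ∩ (Λ i)ᶜ))) ε Vk →
      wilsonLoc ((plaqsOf (maxDomT ν.M₁ (Z i) 1)).indicator fun _ => (1 : ℝ))
        (bgKZstd (Node00.bgMSCoPOfRecord F 2 ν Kt (k i) (maxDomT ν.M₁ (Z i))) ν.M₁ (Z i) (k i) (ext i Vk)) ≤ cA * ε ^ 2)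
    (hcJ' : ∀ i, 2 * cA * eR i / R i + 4 * 𝓐 i / (R i * eR i) ≤ cJ)
    : ∃ a₁ : ι → ℝ, (∀ i, 0 < a₁ i) ∧
      B15.Prop1Printed (lfVarOn su2Chart fun i =>
        InstOn.std (Node00.bgMSCoPOfRecord F 2 ν Kt (k i) (maxDomT ν.M₁ (Z i))) ν.M₁ (Z i) (Λ i) (k i) (M i) (a₁ i)
          (anExt (pts (k i) (Λ i)) (T i)
            (fun177std (Node00.bgMSCoPOfRecord F 2 ν Kt (k i) (maxDomT ν.M₁ (Z i))) ν.M₁ (Z i) (k i)) (ext i)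
            (min (1 / 2) (min (R i / 8) (γ / (M i) ^ 5 * (R i / 2) ^ 2 / (48 * (4 * 𝓐 i / R i + 1))))))) := by
  subst hcl
  exact exists_domain_prop1Printed_lfVarOn_ofFun_intrinsic_analytic hd3 h0 Z Λ k M
    (fun i => fun177std (Node00.bgMSCoPOfRecord F 2 ν Kt (k i) (maxDomT ν.M₁ (Z i))) ν.M₁ (Z i) (k i))
    (fun i u V => fun177std_bgOfRecord_gaugeAct (Node00.avOfRecord F 2 Kt)
      (gaugeAct_mem_regMSCoPOfRecord ν Kt (k i) (maxDomT ν.M₁ (Z i))) ν.M₁ (Z i) (hk i) u V)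
    eR heR T lo hi n hn hN hbox hZ hTG0 hN5 K hK1 hKn ext hext hlohi hγ hcJ hbx hbxM hM hR h𝓐 n' hn' hGj hlead hsm hγle
    (hJ_of_nearValue Z Λ k
      (fun i => fun177std (Node00.bgMSCoPOfRecord F 2 ν Kt (k i) (maxDomT ν.M₁ (Z i))) ν.M₁ (Z i) (k i))
      (fun i V => wilsonLoc ((plaqsOf (maxDomT ν.M₁ (Z i) 1)).indicator fun _ => (1 : ℝ))
        (bgKZstd (Node00.bgMSCoPOfRecord F 2 ν Kt (k i) (maxDomT ν.M₁ (Z i))) ν.M₁ (Z i) (k i) V))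
      (fun _ _ => wilsonLoc_nonneg _ _ fun p => Set.indicator_nonneg (fun _ _ => zero_le_one) p) eR heR T ext hR hGj
      (fun i Vk _ => fun177std_dichotomy (Node00.avOfRecord F 2 Kt)
        (Node00.regMSCoPOfRecord F 2 ν Kt (k i) (maxDomT ν.M₁ (Z i))) ν.M₁ (hk0 i) (hk i) (T i) (hfar i) (ext i Vk))
      hVn hcJ')

end ZSequenceHull

/-! ## §3 The same with print's full top domain `Ω₀ = Z` as support ([15] (2) at `j = 0` on `Z` verbatim): `Node00.bgMSCoPOfRecordAt F 2 ν Kt k Z (maxDomT ν.M₁ Z)` -/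

section ZSequenceTop

open Classical

/-- ★★★ **PROPOSITION 1 [IV] WITH ITS ANALYTIC-EXTENSION CLAUSE AT PRINT'S (1.74) OBJECT `U_{k,Z} = U(𝔹_k(Z), ·)`** — per instance `i` the background
is NODE 00's v1.5 class constructor APPLIED TO `Z`'s maximal sequence (2.13): `Node00.bgMSCoPOfRecordAt F 2 ν Kt (k i) (Z i) (maxDomT ν.M₁ (Z i))`,
i.e. the (2.12) solution map over [15]'s class (2) `𝔘_k({Ω_n(Z)}, εreg)` (support `Ω₀ := Z = Ω₀(Z)`, `B14.Eq213DetSet.maxDomT_zero`; (1.7) ∧ (1.9) on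
the plaquettes ∕ bonds meeting `Ω_n(Z)`, `n ≤ k`) — the SAME sequence whose determining set `𝔹_k(Z) = genSet (maxDomT ν.M₁ Z) k` carries the
constraints — §2's twin with the support enlarged from `hull(Ω₁(Z))` to print's `Ω₀ = Z` (only the scale-`0` class clause on the pinned collar
`Z ∖ hull(Ω₁(Z))` differs, a feasibility condition on the datum).  The class invariance is DISCHARGED
(`B15Eq177ValueInvarianceCoDiv.gaugeAct_mem_regMSCoPOfRecordAt`, [15] p. 278 *«The space 𝔘_k({Ω_j}, ε₀) is gauge invariant»*).  WHAT A CONSUMER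
SUPPLIES: (J1) `hGj`, (L2) `hlead` + `hsm`∕`hγle`, (L3) `hJ` about `A ∘ U_{k,Z}` at THIS background, `k i ≤ m + K`, structure, `hcl := Subsingleton.elim _ _`.
[cite: Balaban1989LargeFieldI, (1.74) p.192, Prop. 1 (1.77)–(1.78) p.194 (incl. the last clause), p.193; Balaban1988Convergent, (2.12)–(2.13) pp.256–257;
Balaban1985Variational, (2),(5),(6) p.278, Prop. 9 p.309; Balaban1989LargeFieldII, (1.7)–(1.9) p.358, (1.11)–(1.13) p.359] -/
theorem exists_domain_prop1Printed_lfVarOn_std_su2_box_intrinsic_analytic_atZSeqCoPRecordTop {F : T4Family} (ν : Node00.Stage7Numerics)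
    (Kt : ℕ) (hd3 : 3 ≤ (F.P Kt).d) (h0 : 0 < (F.P Kt).d) {ι : Type}
    -- bond decidability: the consumer's instance, pinned propositionally to the chain's classical one (`hcl := Subsingleton.elim _ _`)
    [hdec : ∀ j, DecidableEq (PBond (F.P Kt) j)] (hcl : hdec = fun _ a b => Classical.propDecidable (a = b))
    (Z Λ : ι → Set (Site (F.P Kt) 0)) (k : ι → ℕ) (M : ι → ℝ) (hk : ∀ i, k i ≤ (F.P Kt).m + (F.P Kt).K)
    (eR : ι → ℝ) (heR : ∀ i, 0 < eR i)
    (T : ∀ i, Finset (PBond (F.P Kt) (k i)))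
    (lo hi : ι → Fin (F.P Kt).d → ℤ) (n : ι → ℕ) (hn : ∀ i κ, hi i κ ≤ lo i κ + n i) (hN : ∀ i, n i + 2 < (F.P Kt).sitesPerDir (k i))
    (hbox : ∀ i, pts (k i) (Λ i) = (castSite '' Set.Icc (lo i) (hi i) : Set (Site (F.P Kt) (k i))))
    (hZ : ∀ i, (boxPlaqs (lo i - 1) (hi i + 1) : Set (Plaq (F.P Kt) (k i))) ⊆ plaqsInside (pts (k i) (Z i)))
    (hTG0 : ∀ i, T i = (box (fun κ => (hi i κ - lo i κ + 1).toNat) (lo i)).image fun x =>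
      (⟨castSite (x - unitVec ⟨0, h0⟩), ⟨0, h0⟩⟩ : PBond (F.P Kt) (k i)))
    (hN5 : ∀ i κ, ((hi i κ - lo i κ + 1).toNat : ℤ) + 5 < (F.P Kt).sitesPerDir (k i))
    (K : ι → ℕ) (hK1 : ∀ i, 1 ≤ K i) (hKn : ∀ i κ, (hi i κ - lo i κ + 1).toNat ≤ K i)
    (ext : ∀ i, GaugeField (F.P Kt) (k i) SU2 → GaugeField (F.P Kt) (k i) SU2)
    (hext : ∀ i Vk, ext i Vk = extend (pts (k i) (Λ i)) (shellGauge Vk (lo i) (hi i)) Vk)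
    (hlohi : ∀ i, lo i ≤ hi i)
    {γ cJ bx : ℝ} (hγ : 0 < γ) (hcJ : 0 ≤ cJ) (hbx : 0 ≤ bx)
    (hbxM : ∀ i, 12 * ((F.P Kt).d : ℝ) * ((n i : ℝ) + 2) ^ 2 ≤ bx * (M i) ^ 2)
    {Cerr R 𝓐 : ι → ℝ} (hM : ∀ i, 1 ≤ (M i)) (hR : ∀ i, 0 < R i) (h𝓐 : ∀ i, 0 ≤ 𝓐 i)
    (n' : ι → ℕ) (hn' : ∀ i, 1 ≤ n' i)
    -- (J1) the JOINT holomorphic extension of print's function in the datum perturbation and the field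
    (hGj : ∀ i Vk, PlaqSmallOn (plaqsInside (pts (k i) (Z i ∩ (Λ i)ᶜ))) (eR i) Vk →
      ∃ 𝒢 : VecField (F.P Kt) (k i) (EuclideanSpace ℂ (Fin 3)) × VecField (F.P Kt) (k i) (EuclideanSpace ℂ (Fin 3)) → ℂ,
        DifferentiableOn ℂ 𝒢 (ball 0 (R i)) ∧
        (∀ z ∈ ball (0 : VecField (F.P Kt) (k i) (EuclideanSpace ℂ (Fin 3)) × VecField (F.P Kt) (k i) (EuclideanSpace ℂ (Fin 3))) (R i), ‖𝒢 z‖ ≤ 𝓐 i) ∧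
        ∀ p B' : VecField (F.P Kt) (k i) E3, ‖p‖ < R i → ‖B'‖ < R i →
          𝒢 (cplxVec p, cplxVec B') =
            ((fun177std (Node00.bgMSCoPOfRecordAt F 2 ν Kt (k i) (Z i) (maxDomT ν.M₁ (Z i))) ν.M₁ (Z i) (k i)
              (expMul su2Chart B' (ext i (expMul su2Chart p Vk))) : ℝ) : ℂ))
    -- (L2) (1.7)–(1.9) p.358 for the Hessian of the slice function at `0`
    (hlead : ∀ i Vk, PlaqSmallOn (plaqsInside (pts (k i) (Z i ∩ (Λ i)ᶜ))) (eR i) Vk →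
      ∀ X : GaugeSlice (pts (k i) (Λ i)) (T i) E3,
      |⟪X, (fderiv ℝ (rGrad (pts (k i) (Λ i)) (T i)
              (sliceFn (pts (k i) (Λ i)) (T i)
                (fun177std (Node00.bgMSCoPOfRecordAt F 2 ν Kt (k i) (Z i) (maxDomT ν.M₁ (Z i))) ν.M₁ (Z i) (k i)) (ext i Vk))) 0) X⟫ -
          ∑ a : Fin 3, formDk (n' i) (fun _ : Fin (F.P Kt).d => (F.P Kt).sitesPerDir (k i))
            (ofRealCfg (fun _ : Fin (F.P Kt).d => (F.P Kt).sitesPerDir (k i)) fun j =>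
              ιA (pts (k i) (Λ i)) (T i) X ⟨j.1, j.2⟩ a)| ≤ Cerr i * ‖X‖ ^ 2)
    (hsm : ∀ i, Cerr i ≤ (4 / Real.pi ^ 2) ^ ((F.P Kt).d + 2) / (2 * (3 * (K i : ℝ) ^ 2 + 2 * (K i : ℝ) ^ 4)))
    (hγle : ∀ i, γ / (M i) ^ 5 ≤ (4 / Real.pi ^ 2) ^ ((F.P Kt).d + 2) / (2 * (3 * (K i : ℝ) ^ 2 + 2 * (K i : ℝ) ^ 4)))
    -- (L3) p.359: the gradient at `0` is small at regular data
    (hJ : ∀ i ε Vk, 0 < ε → ε ≤ eR i → PlaqSmallOn (plaqsInside (pts (k i) (Z i ∩ (Λ i)ᶜ))) ε Vk →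
      ‖rGrad (pts (k i) (Λ i)) (T i)
        (sliceFn (pts (k i) (Λ i)) (T i)
          (fun177std (Node00.bgMSCoPOfRecordAt F 2 ν Kt (k i) (Z i) (maxDomT ν.M₁ (Z i))) ν.M₁ (Z i) (k i)) (ext i Vk)) 0‖ ≤ cJ * ε)
    : ∃ a₁ : ι → ℝ, (∀ i, 0 < a₁ i) ∧
      B15.Prop1Printed (lfVarOn su2Chart fun i =>
        InstOn.std (Node00.bgMSCoPOfRecordAt F 2 ν Kt (k i) (Z i) (maxDomT ν.M₁ (Z i))) ν.M₁ (Z i) (Λ i) (k i) (M i) (a₁ i)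
          (anExt (pts (k i) (Λ i)) (T i)
            (fun177std (Node00.bgMSCoPOfRecordAt F 2 ν Kt (k i) (Z i) (maxDomT ν.M₁ (Z i))) ν.M₁ (Z i) (k i)) (ext i)
            (min (1 / 2) (min (R i / 8) (γ / (M i) ^ 5 * (R i / 2) ^ 2 / (48 * (4 * 𝓐 i / R i + 1))))))) := by
  subst hcl
  exact exists_domain_prop1Printed_lfVarOn_ofFun_intrinsic_analytic hd3 h0 Z Λ k M
    (fun i => fun177std (Node00.bgMSCoPOfRecordAt F 2 ν Kt (k i) (Z i) (maxDomT ν.M₁ (Z i))) ν.M₁ (Z i) (k i))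
    (fun i u V => fun177std_bgOfRecord_gaugeAct (Node00.avOfRecord F 2 Kt)
      (gaugeAct_mem_regMSCoPOfRecordAt ν Kt (k i) (Z i) (maxDomT ν.M₁ (Z i))) ν.M₁ (Z i) (hk i) u V)
    eR heR T lo hi n hn hN hbox hZ hTG0 hN5 K hK1 hKn ext hext hlohi hγ hcJ hbx hbxM hM hR h𝓐 n' hn' hGj hlead hsm hγle hJ

/-- ★★★ **PROPOSITION 1 [IV] WITH ITS ANALYTIC-EXTENSION CLAUSE AT PRINT'S (1.74) OBJECT, WITH THE GRADIENT LETTER (L3) REPLACED BY THE NEAR-FIELD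
VALUE LETTER (Vn), TOP DOMAIN `Ω₀ = Z`** — per instance the background `Node00.bgMSCoPOfRecordAt F 2 ν Kt (k i) (Z i) (maxDomT ν.M₁ (Z i))` (the (2.12)
solution map of `Z`'s own maximal sequence with support `Z`, class invariance DISCHARGED by `gaugeAct_mem_regMSCoPOfRecordAt`); §2's twin.  WHAT A
CONSUMER SUPPLIES: (J1) `hGj`, (L2) `hlead` + `hsm`∕`hγle`, (Vn) `hVn : Σ_{p ∈ plaqsOf Ω₁(Z)} (1 − Re tr U_{k,Z}(ext V_k)(∂p)) ≤ cA·ε²` at `ε`-regular data —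
print's (8) for `U_{k,Z}` ([IV] p. 193 ll. 17–20; at this background = [15] Thm 1 (8) for the admissible sequence `maxDomT ν.M₁ Z`, LOCATED-GENFORM of the
module docstring) via `B15Prop1GradientFromNearValueAtCoPRecord.nearValue_le_of_plaqSmallOn` — `hcJ' : 2cA·eR∕R + 4𝓐∕(R·eR) ≤ cJ`, the geometric letter
`hfar` (`…AtCoPRecord.far_letter_of_box`), `0 < k i ≤ m + K`, structure, `hcl := Subsingleton.elim _ _`.
[cite: Balaban1989LargeFieldI, (1.74) p.192, Prop. 1 (1.77)–(1.78) p.194 (incl. the last clause), p.193; Balaban1988Convergent, (2.12)–(2.13) pp.256–257;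
Balaban1985Variational, (2),(5),(6) p.278, Thm 1 (8) p.279, Prop. 9 p.309; Balaban1989LargeFieldII, (1.7)–(1.9) p.358, (1.11) p.358, (1.12)–(1.13) p.359] -/
theorem exists_domain_prop1Printed_lfVarOn_std_su2_box_intrinsic_analytic_atZSeqCoPRecordTop_ofNearValue {F : T4Family}
    (ν : Node00.Stage7Numerics) (Kt : ℕ) (hd3 : 3 ≤ (F.P Kt).d) (h0 : 0 < (F.P Kt).d) {ι : Type}
    [hdec : ∀ j, DecidableEq (PBond (F.P Kt) j)] (hcl : hdec = fun _ a b => Classical.propDecidable (a = b))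
    (Z Λ : ι → Set (Site (F.P Kt) 0)) (k : ι → ℕ) (M : ι → ℝ) (hk0 : ∀ i, 0 < k i) (hk : ∀ i, k i ≤ (F.P Kt).m + (F.P Kt).K)
    (eR : ι → ℝ) (heR : ∀ i, 0 < eR i)
    (T : ∀ i, Finset (PBond (F.P Kt) (k i)))
    (lo hi : ι → Fin (F.P Kt).d → ℤ) (n : ι → ℕ) (hn : ∀ i κ, hi i κ ≤ lo i κ + n i) (hN : ∀ i, n i + 2 < (F.P Kt).sitesPerDir (k i))
    (hbox : ∀ i, pts (k i) (Λ i) = (castSite '' Set.Icc (lo i) (hi i) : Set (Site (F.P Kt) (k i))))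
    (hZ : ∀ i, (boxPlaqs (lo i - 1) (hi i + 1) : Set (Plaq (F.P Kt) (k i))) ⊆ plaqsInside (pts (k i) (Z i)))
    (hTG0 : ∀ i, T i = (box (fun κ => (hi i κ - lo i κ + 1).toNat) (lo i)).image fun x =>
      (⟨castSite (x - unitVec ⟨0, h0⟩), ⟨0, h0⟩⟩ : PBond (F.P Kt) (k i)))
    (hN5 : ∀ i κ, ((hi i κ - lo i κ + 1).toNat : ℤ) + 5 < (F.P Kt).sitesPerDir (k i))
    (K : ι → ℕ) (hK1 : ∀ i, 1 ≤ K i) (hKn : ∀ i κ, (hi i κ - lo i κ + 1).toNat ≤ K i)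
    (ext : ∀ i, GaugeField (F.P Kt) (k i) SU2 → GaugeField (F.P Kt) (k i) SU2)
    (hext : ∀ i Vk, ext i Vk = extend (pts (k i) (Λ i)) (shellGauge Vk (lo i) (hi i)) Vk)
    (hlohi : ∀ i, lo i ≤ hi i)
    {γ cJ bx : ℝ} (hγ : 0 < γ) (hcJ : 0 ≤ cJ) (hbx : 0 ≤ bx)
    (hbxM : ∀ i, 12 * ((F.P Kt).d : ℝ) * ((n i : ℝ) + 2) ^ 2 ≤ bx * (M i) ^ 2)
    {Cerr R 𝓐 : ι → ℝ} (hM : ∀ i, 1 ≤ (M i)) (hR : ∀ i, 0 < R i) (h𝓐 : ∀ i, 0 ≤ 𝓐 i)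
    (n' : ι → ℕ) (hn' : ∀ i, 1 ≤ n' i)
    -- (J1) the JOINT holomorphic extension of print's function in the datum perturbation and the field
    (hGj : ∀ i Vk, PlaqSmallOn (plaqsInside (pts (k i) (Z i ∩ (Λ i)ᶜ))) (eR i) Vk →
      ∃ 𝒢 : VecField (F.P Kt) (k i) (EuclideanSpace ℂ (Fin 3)) × VecField (F.P Kt) (k i) (EuclideanSpace ℂ (Fin 3)) → ℂ,
        DifferentiableOn ℂ 𝒢 (ball 0 (R i)) ∧
        (∀ z ∈ ball (0 : VecField (F.P Kt) (k i) (EuclideanSpace ℂ (Fin 3)) × VecField (F.P Kt) (k i) (EuclideanSpace ℂ (Fin 3))) (R i), ‖𝒢 z‖ ≤ 𝓐 i) ∧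
        ∀ p B' : VecField (F.P Kt) (k i) E3, ‖p‖ < R i → ‖B'‖ < R i →
          𝒢 (cplxVec p, cplxVec B') =
            ((fun177std (Node00.bgMSCoPOfRecordAt F 2 ν Kt (k i) (Z i) (maxDomT ν.M₁ (Z i))) ν.M₁ (Z i) (k i)
              (expMul su2Chart B' (ext i (expMul su2Chart p Vk))) : ℝ) : ℂ))
    -- (L2) (1.7)–(1.9) p.358 for the Hessian of the slice function at `0`
    (hlead : ∀ i Vk, PlaqSmallOn (plaqsInside (pts (k i) (Z i ∩ (Λ i)ᶜ))) (eR i) Vk →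
      ∀ X : GaugeSlice (pts (k i) (Λ i)) (T i) E3,
      |⟪X, (fderiv ℝ (rGrad (pts (k i) (Λ i)) (T i)
              (sliceFn (pts (k i) (Λ i)) (T i)
                (fun177std (Node00.bgMSCoPOfRecordAt F 2 ν Kt (k i) (Z i) (maxDomT ν.M₁ (Z i))) ν.M₁ (Z i) (k i)) (ext i Vk))) 0) X⟫ -
          ∑ a : Fin 3, formDk (n' i) (fun _ : Fin (F.P Kt).d => (F.P Kt).sitesPerDir (k i))
            (ofRealCfg (fun _ : Fin (F.P Kt).d => (F.P Kt).sitesPerDir (k i)) fun j =>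
              ιA (pts (k i) (Λ i)) (T i) X ⟨j.1, j.2⟩ a)| ≤ Cerr i * ‖X‖ ^ 2)
    (hsm : ∀ i, Cerr i ≤ (4 / Real.pi ^ 2) ^ ((F.P Kt).d + 2) / (2 * (3 * (K i : ℝ) ^ 2 + 2 * (K i : ℝ) ^ 4)))
    (hγle : ∀ i, γ / (M i) ^ 5 ≤ (4 / Real.pi ^ 2) ^ ((F.P Kt).d + 2) / (2 * (3 * (K i : ℝ) ^ 2 + 2 * (K i : ℝ) ^ 4)))
    -- the geometric letter: the k-blocks over the bonds meeting `Λ^{(k)}` lie inside `Ω₁(Z)` (print: `Λ` deep inside `Z`)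
    (hfar : ∀ i (b : PBond (F.P Kt) 0), b.src ∉ maxDomT ν.M₁ (Z i) 1 →
      (⟨blockIter (k i) b.src, b.dir⟩ : PBond (F.P Kt) (k i)) ∉ bondsOf (pts (k i) (Λ i)))
    -- (Vn) the NEAR-FIELD part of (1.77) at the extended regular datum is small (replaces (L3))
    {cA : ℝ}
    (hVn : ∀ i ε Vk, 0 < ε → ε ≤ eR i → PlaqSmallOn (plaqsInside (pts (k i) (Z i ∩ (Λ i)ᶜ))) ε Vk →
      wilsonLoc ((plaqsOf (maxDomT ν.M₁ (Z i) 1)).indicator fun _ => (1 : ℝ))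
        (bgKZstd (Node00.bgMSCoPOfRecordAt F 2 ν Kt (k i) (Z i) (maxDomT ν.M₁ (Z i))) ν.M₁ (Z i) (k i) (ext i Vk)) ≤ cA * ε ^ 2)
    (hcJ' : ∀ i, 2 * cA * eR i / R i + 4 * 𝓐 i / (R i * eR i) ≤ cJ)
    : ∃ a₁ : ι → ℝ, (∀ i, 0 < a₁ i) ∧
      B15.Prop1Printed (lfVarOn su2Chart fun i =>
        InstOn.std (Node00.bgMSCoPOfRecordAt F 2 ν Kt (k i) (Z i) (maxDomT ν.M₁ (Z i))) ν.M₁ (Z i) (Λ i) (k i) (M i) (a₁ i)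
          (anExt (pts (k i) (Λ i)) (T i)
            (fun177std (Node00.bgMSCoPOfRecordAt F 2 ν Kt (k i) (Z i) (maxDomT ν.M₁ (Z i))) ν.M₁ (Z i) (k i)) (ext i)
            (min (1 / 2) (min (R i / 8) (γ / (M i) ^ 5 * (R i / 2) ^ 2 / (48 * (4 * 𝓐 i / R i + 1))))))) := by
  subst hcl
  exact exists_domain_prop1Printed_lfVarOn_ofFun_intrinsic_analytic hd3 h0 Z Λ k M
    (fun i => fun177std (Node00.bgMSCoPOfRecordAt F 2 ν Kt (k i) (Z i) (maxDomT ν.M₁ (Z i))) ν.M₁ (Z i) (k i))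
    (fun i u V => fun177std_bgOfRecord_gaugeAct (Node00.avOfRecord F 2 Kt)
      (gaugeAct_mem_regMSCoPOfRecordAt ν Kt (k i) (Z i) (maxDomT ν.M₁ (Z i))) ν.M₁ (Z i) (hk i) u V)
    eR heR T lo hi n hn hN hbox hZ hTG0 hN5 K hK1 hKn ext hext hlohi hγ hcJ hbx hbxM hM hR h𝓐 n' hn' hGj hlead hsm hγle
    (hJ_of_nearValue Z Λ k
      (fun i => fun177std (Node00.bgMSCoPOfRecordAt F 2 ν Kt (k i) (Z i) (maxDomT ν.M₁ (Z i))) ν.M₁ (Z i) (k i))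
      (fun i V => wilsonLoc ((plaqsOf (maxDomT ν.M₁ (Z i) 1)).indicator fun _ => (1 : ℝ))
        (bgKZstd (Node00.bgMSCoPOfRecordAt F 2 ν Kt (k i) (Z i) (maxDomT ν.M₁ (Z i))) ν.M₁ (Z i) (k i) V))
      (fun _ _ => wilsonLoc_nonneg _ _ fun p => Set.indicator_nonneg (fun _ _ => zero_le_one) p) eR heR T ext hR hGj
      (fun i Vk _ => fun177std_dichotomy (Node00.avOfRecord F 2 Kt)
        (Node00.regMSCoPOfRecordAt F 2 ν Kt (k i) (Z i) (maxDomT ν.M₁ (Z i))) ν.M₁ (hk0 i) (hk i) (T i) (hfar i) (ext i Vk))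
      hVn hcJ')

end ZSequenceTop

end Literature.MathematicalPhysics.QuantumFieldTheory.Balaban1983to89.B15Prop1AtZSequenceRecord

end
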